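import Literature.AnabelianGeometry.AbsoluteAnabelian.AbsTopIII.HolLogObservableBoundary
import Literature.AnabelianGeometry.AbsoluteAnabelian.AbsTopIII.AutHolLogFrobeniusDescent
import HarnessLib

/-!
# [AbsTopIII] Corollary 3.6 (iii), first clause, over the abstract data: the observable `𝔖_log`
# in the holomorphic orientation

Mochizuki, *Topics in Absolute Anabelian Geometry III*, Corollary 3.6 (iii) p.81 (bib key
`MochizukiAbsTopIII2015`; lit key `paper:url-5493eb38cbb7`): "The natural transformations
`ι_log,⋎ : λ^× ∘ id_⋎ ∘ log → λ^{×pf} ∘ id_{⋎+1}`, `ι_× : λ^× → λ^{×pf}` belong to a family of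
homotopies on `𝒟_{≤3}` that determines on `𝒟_{≤3}` a structure of observable `𝔖_log` on `𝒟_{≤2}`";
proof p.81: `E_log` = the pairs of the three types (1) `([λ^×]∘[id_⋎]∘[log]∘[γ], [λ^{×pf}]∘[id_{⋎+1}]∘[γ])`,
(2) `([λ^×]∘[γ], [λ^{×pf}]∘[γ])`, (3) `([γ],[γ])` — here, unlike §4 (Cor. 4.5 (iii),
`AutHolLogFrobeniusObservable.lean`), no two non-trivial pairs compose, so the family is given by
ONE whiskered `ι_log,⋎` or `ι_×` per pair.  For EVERY input datum `Δ : LogFrobeniusData` of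
holomorphic type (`Δ.ιtimes = inl ι`, `ι : λ^× → λ^{×pf}`) this file constructs the family
(`hLogFamily`, via t12's `HomotopyFamily.mkOfStrict`) and PROVES seat abc-iut-L4-t5's pinned
`LogFrobeniusData.ObservableLogStmt`: `observableLogStmt_of_inl` (node `AbsTopIII:Cor3.6(iii)`, first
clause; the second clause `IotaOverGaloisStmt` and the rest of Cor. 3.6 stay with abc-iut-L4-t5;
coordination STATUS 20:14:06Z / 20:27Z).  Built on `HolLogObservableBoundary.lean` (boundary set), the orientation-free files
`LogObservablePaths` / `LogObservableLevels`, and `stepTimes` of `AutHolLogFrobeniusDescent` (seat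
abc-iut-L4-t10).
-/

namespace Literature.AnabelianGeometry.AbsoluteAnabelian.AbsTopIII

open _root_.CategoryTheory _root_.Quiver LogFrobeniusData

universe u

/-! ### The homotopies -/

section Family

variable (Δ : LogFrobeniusData.{u}) (ι : Δ.lamTimes ⟶ Δ.lamPf)

/-- Type (2) homotopy, last-edge layer: `ι_×` whiskered by the prefix.
[cite: MochizukiAbsTopIII2015, Corollary 3.6 (iii) p.81] -/
def swapEtaAux {a : V3.{u}} : ∀ (x y : V3.{u}) (p : Path a x) (e : x ⟶ y),
    (Δ.sub3.pathFunctor' (p.cons e) ⟶ Δ.sub3.pathFunctor' (swapLastAux x y p e))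
  | .base ⟨.nexus, _⟩, .obs, p, ⟨true⟩ => Functor.whiskerLeft (Δ.sub3.pathFunctor' p) ι
  | .base ⟨.nexus, _⟩, .obs, _, ⟨false⟩ => 𝟙 _
  | .base ⟨.nexus, _⟩, .base _, _, _ => 𝟙 _
  | .base ⟨.row1 _, _⟩, _, _, _ => 𝟙 _
  | .base ⟨.third, _⟩, _, _, _ => 𝟙 _
  | .base ⟨.fourth, _⟩, _, _, _ => 𝟙 _
  | .base ⟨.fifth, _⟩, _, _, _ => 𝟙 _
  | .base ⟨.sixth, _⟩, _, _, _ => 𝟙 _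
  | .obs, _, _, _ => 𝟙 _

/-- Type (2) homotopy `𝒟_[p] → 𝒟_[swapLast p]`. [cite: MochizukiAbsTopIII2015, Corollary 3.6 (iii)
p.81] -/
def swapEta {a : V3.{u}} : ∀ {b : V3.{u}} (p : Path a b),
    (Δ.sub3.pathFunctor' p ⟶ Δ.sub3.pathFunctor' (swapLast p))
  | _, .nil => 𝟙 _
  | _, .cons (b := x) (c := y) p e => swapEtaAux Δ ι x y p e

/-- Type (1) homotopy, last-edge layer: `ι_log,⋎` whiskered by the prefix (via `stepTimes`).
[cite: MochizukiAbsTopIII2015, Corollary 3.6 (iii) p.81] -/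
def hstepLast {a : V3.{u}} : ∀ (x y : V3.{u}) (p : Path a x) (e : x ⟶ y),
    (Δ.sub3.pathFunctor' (p.cons e) ⟶ Δ.sub3.pathFunctor' (hlowerLast x y p e))
  | .base ⟨.nexus, h⟩, .obs, p, ⟨true⟩ => stepTimes Δ h p
  | .base ⟨.nexus, _⟩, .obs, _, ⟨false⟩ => 𝟙 _
  | .base ⟨.nexus, _⟩, .base _, _, _ => 𝟙 _
  | .base ⟨.row1 _, _⟩, _, _, _ => 𝟙 _
  | .base ⟨.third, _⟩, _, _, _ => 𝟙 _
  | .base ⟨.fourth, _⟩, _, _, _ => 𝟙 _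
  | .base ⟨.fifth, _⟩, _, _, _ => 𝟙 _
  | .base ⟨.sixth, _⟩, _, _, _ => 𝟙 _
  | .obs, _, _, _ => 𝟙 _

/-- Type (1) homotopy `𝒟_[p] → 𝒟_[hlower p]`. [cite: MochizukiAbsTopIII2015, Corollary 3.6 (iii)
p.81] -/
def hstep {a : V3.{u}} : ∀ {b : V3.{u}} (p : Path a b),
    (Δ.sub3.pathFunctor' p ⟶ Δ.sub3.pathFunctor' (hlower p))
  | _, .nil => 𝟙 _
  | _, .cons (b := x) (c := y) p e => hstepLast Δ x y p e

/-- In the branch "same last edge" the pair is reflexive.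
[cite: MochizukiAbsTopIII2015, Corollary 3.6 (iii) p.81] -/
theorem HLogRel.eq_of_lastTimes_eq {a b : V3.{u}} {p q : Path a b} (h : HLogRel p q)
    (h₁ : lastTimes q = lastTimes p) : q = p := by
  obtain ⟨rfl, ha, hq⟩ := h
  rcases hq with rfl | ⟨hp, rfl | rfl⟩
  · rfl
  · rw [(swapLast_spec p ha hp).1, hp] at h₁; exact absurd h₁ (by decide)
  · rcases hlower_spec p ha hp with hfix | ⟨hl, -, -⟩
    · exact hfix
    · rw [hl, hp] at h₁; exact absurd h₁ (by decide)

/-- In the branch "different last edge, same number of `log`s" the pair is of type (2).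
[cite: MochizukiAbsTopIII2015, Corollary 3.6 (iii) p.81] -/
theorem HLogRel.eq_swapLast {a b : V3.{u}} {p q : Path a b} (h : HLogRel p q)
    (h₁ : ¬ lastTimes q = lastTimes p) (h₂ : nlogs q = nlogs p) : q = swapLast p := by
  obtain ⟨rfl, ha, hq⟩ := h
  rcases hq with rfl | ⟨hp, rfl | rfl⟩
  · exact absurd rfl h₁
  · rfl
  · rcases hlower_spec p ha hp with hfix | ⟨-, hn, -⟩
    · rw [hfix] at h₁; exact absurd rfl h₁
    · omega

/-- In the remaining branch the pair is of type (1).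
[cite: MochizukiAbsTopIII2015, Corollary 3.6 (iii) p.81] -/
theorem HLogRel.eq_hlower {a b : V3.{u}} {p q : Path a b} (h : HLogRel p q)
    (h₁ : ¬ lastTimes q = lastTimes p) (h₂ : ¬ nlogs q = nlogs p) : q = hlower p := by
  obtain ⟨rfl, ha, hq⟩ := h
  rcases hq with rfl | ⟨hp, rfl | rfl⟩
  · exact absurd rfl h₁
  · exact absurd (swapLast_spec p ha hp).2 h₂
  · rfl

/-- **The homotopies of `𝔖_log`** (holomorphic orientation, strict form): the identity on a
reflexive
pair, `ι_×` whiskered on a type-(2) pair, `ι_log,⋎` whiskered on a type-(1) pair — the branch being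
read off the last edges and the numbers of `log`s. [cite: MochizukiAbsTopIII2015, Corollary 3.6 (iii) p.81] -/
noncomputable def hLogEta {a b : V3.{u}} {p q : Path a b} (h : HLogRel p q) :
    Δ.sub3.pathFunctor' p ⟶ Δ.sub3.pathFunctor' q :=
  if h₁ : lastTimes q = lastTimes p then eqToHom (congrArg Δ.sub3.pathFunctor' (h.eq_of_lastTimes_eq h₁).symm)
  else if h₂ : nlogs q = nlogs p then
    swapEta Δ ι p ≫ eqToHom (congrArg Δ.sub3.pathFunctor' (h.eq_swapLast h₁ h₂).symm)
  else hstep Δ p ≫ eqToHom (congrArg Δ.sub3.pathFunctor' (h.eq_hlower h₁ h₂).symm)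

/-- Def. 3.5 (ii): the homotopy of `([γ],[γ])` is the identity.
[cite: MochizukiAbsTopIII2015, Corollary 3.6 (iii) p.81] -/
theorem hLogEta_refl {a b : V3.{u}} {p : Path a b} (h : HLogRel p p) : hLogEta Δ ι h = 𝟙 _ := by
  unfold hLogEta; rw [dif_pos rfl]; simp

/-- Def. 3.5 (ii): homotopies compose along `E_log` (here one factor is always an identity).
[cite: MochizukiAbsTopIII2015, Corollary 3.6 (iii) p.81] -/
theorem hLogEta_trans {a b : V3.{u}} {p q r : Path a b} (h₁ : HLogRel p q) (h₂ : HLogRel q r) :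
    hLogEta Δ ι (isSaturated_hLogRel.trans h₁ h₂) = hLogEta Δ ι h₁ ≫ hLogEta Δ ι h₂ := by
  have hb := h₁.1
  subst hb
  have ha := h₁.2.1
  by_cases hqp : q = p
  · subst hqp
    rw [hLogEta_refl, Category.id_comp]
  · have hql : lastTimes q = false := by
      rcases h₁.2.2 with rfl | ⟨hp, rfl | rfl⟩
      · exact absurd rfl hqp
      · exact (swapLast_spec p ha hp).1
      · rcases hlower_spec p ha hp with hfix | ⟨hl, -, -⟩
        · exact absurd hfix hqp
        · exact hl
    obtain rfl := h₂.eq_of_lastTimes_false hql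
    rw [hLogEta_refl, Category.comp_id]

/-- Left whiskering along propositionally equal functors (transport by `eqToHom`). [folklore] -/
private theorem whiskerLeft_congr_left' {C₁ : Type*} [Category C₁] {C₂ : Type*} [Category C₂]
    {C₃ : Type*} [Category C₃] {F F' : C₁ ⥤ C₂} (hF : F = F') {G H : C₂ ⥤ C₃} (α : G ⟶ H) :
    Functor.whiskerLeft F α = eqToHom (by rw [hF]) ≫ Functor.whiskerLeft F' α ≫ eqToHom (by rw [hF]) := by
  subst hF; simp

/-- The last edge of a pre-composed path into `𝒩`. [cite: MochizukiAbsTopIII2015, Corollary 3.6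
p.78] -/
theorem lastTimes_comp {c a : V3.{u}} (r : Path c a) (p : Path a lvObs.{u}) (ha : a ≠ lvObs.{u}) :
    lastTimes (r.comp p) = lastTimes p := by
  cases p with
  | nil => exact absurd rfl ha
  | cons p₀ e => rfl

/-- `swapLast` commutes with pre-composition (paths into `𝒩`).
[cite: MochizukiAbsTopIII2015, Corollary 3.6 (iii) p.81] -/
theorem swapLast_comp {c a : V3.{u}} (r : Path c a) (p : Path a lvObs.{u}) (ha : a ≠ lvObs.{u}) :
    swapLast (r.comp p) = r.comp (swapLast p) := by
  cases p with
  | nil => exact absurd rfl ha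
  | cons p₀ e =>
    obtain rfl := eq_nexus_of_hom_obs e
    rcases hom_obs_eq e with rfl | rfl <;> rfl

/-- The type-(2) homotopy of a pre-composed path is the whiskered one.
[cite: MochizukiAbsTopIII2015, Corollary 3.6 (iii) p.81] -/
theorem swapEta_comp {c a : V3.{u}} (r : Path c a) (p : Path a lvObs.{u}) (ha : a ≠ lvObs.{u}) :
    swapEta Δ ι (r.comp p) = eqToHom (Δ.sub3.pathFunctor'_comp r p) ≫
      Functor.whiskerLeft (Δ.sub3.pathFunctor' r) (swapEta Δ ι p) ≫
      eqToHom (by rw [swapLast_comp r p ha, DiagramOfCategories.pathFunctor'_comp]) := by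
  cases p with
  | nil => exact absurd rfl ha
  | cons p₀ e =>
    obtain rfl := eq_nexus_of_hom_obs e
    rcases hom_obs_eq e with rfl | rfl
    · exact whiskerLeft_congr_left' (Δ.sub3.pathFunctor'_comp r p₀) ι
    · show 𝟙 _ = eqToHom _ ≫ Functor.whiskerLeft _ (𝟙 _) ≫ eqToHom _
      simp

/-- `hlower` of a genuine type-(1) path commutes with pre-composition.
[cite: MochizukiAbsTopIII2015, Corollary 3.6 (iii) p.81] -/
theorem hlower_comp {c a : V3.{u}} (r : Path c a) {n : ℤ} (p₂ : Path a (lvRow1.{u} (n + 1))) :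
    hlower (r.comp (((p₂.cons (logE n)).cons (idE n)).cons eLamTimes)) =
      r.comp (hlower (((p₂.cons (logE n)).cons (idE n)).cons eLamTimes)) := rfl

/-- The type-(1) homotopy of a pre-composed type-(1) path is the whiskered one.
[cite: MochizukiAbsTopIII2015, Corollary 3.6 (iii) p.81] -/
theorem hstep_comp {c a : V3.{u}} (r : Path c a) {n : ℤ} (p₂ : Path a (lvRow1.{u} (n + 1))) :
    hstep Δ (r.comp (((p₂.cons (logE n)).cons (idE n)).cons eLamTimes)) =
      eqToHom (Δ.sub3.pathFunctor'_comp r _) ≫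
      Functor.whiskerLeft (Δ.sub3.pathFunctor' r) (hstep Δ (((p₂.cons (logE n)).cons (idE n)).cons eLamTimes)) ≫
      eqToHom (by rw [hlower_comp, DiagramOfCategories.pathFunctor'_comp]) :=
  whiskerLeft_congr_left' (Δ.sub3.pathFunctor'_comp r p₂) Δ.ιlog

/-- Def. 3.5 (ii): the homotopies are compatible with pre- and post-composition (whiskering).
[cite: MochizukiAbsTopIII2015, Corollary 3.6 (iii) p.81] -/
theorem hLogEta_whisker {a b c d : V3.{u}} {p q : Path a b} (h : HLogRel p q) (r₁ : Path c a)
    (r₂ : Path b d) :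
    hLogEta Δ ι (isSaturated_hLogRel.precomp (isSaturated_hLogRel.postcomp h r₂) r₁) =
      eqToHom (by rw [DiagramOfCategories.pathFunctor'_comp, DiagramOfCategories.pathFunctor'_comp]) ≫
        Functor.whiskerLeft (Δ.sub3.pathFunctor' r₁)
          (Functor.whiskerRight (hLogEta Δ ι h) (Δ.sub3.pathFunctor' r₂)) ≫
        eqToHom (by rw [DiagramOfCategories.pathFunctor'_comp, DiagramOfCategories.pathFunctor'_comp]) := by
  obtain ⟨hb, ha, hpq⟩ := h
  subst hb
  obtain rfl := path_from_obs r₂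
  obtain rfl := path_obs_obs_eq_nil r₂
  have HL : lastTimes (r₁.comp (q.comp Path.nil)) = lastTimes (r₁.comp (p.comp Path.nil)) ↔
      lastTimes q = lastTimes p := by
    show lastTimes (r₁.comp q) = lastTimes (r₁.comp p) ↔ _
    rw [lastTimes_comp r₁ q ha, lastTimes_comp r₁ p ha]
  have HN : nlogs (r₁.comp (q.comp Path.nil)) = nlogs (r₁.comp (p.comp Path.nil)) ↔ nlogs q = nlogs p := by
    show nlogs (r₁.comp q) = nlogs (r₁.comp p) ↔ _
    rw [nlogs_comp, nlogs_comp]; omega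
  by_cases h₁ : lastTimes q = lastTimes p
  · obtain rfl := HLogRel.eq_of_lastTimes_eq ⟨rfl, ha, hpq⟩ h₁
    unfold hLogEta
    rw [dif_pos (HL.2 h₁), dif_pos h₁]
    simp
  · by_cases h₂ : nlogs q = nlogs p
    · unfold hLogEta
      rw [dif_neg (fun H => h₁ (HL.1 H)), dif_pos (HN.2 h₂), dif_neg h₁, dif_pos h₂]
      rw [swapEta_comp Δ ι r₁ (p.comp Path.nil) ha]
      ext x
      simp only [NatTrans.comp_app, eqToHom_app, Functor.whiskerLeft_app, Functor.whiskerRight_app,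
        DiagramOfCategories.pathFunctor'_nil, Functor.id_map, Category.assoc, eqToHom_trans]
      erw [Category.assoc, eqToHom_trans]
      rfl
    · have hq := HLogRel.eq_hlower ⟨rfl, ha, hpq⟩ h₁ h₂
      have hp : lastTimes p = true := by
        rcases hpq with rfl | ⟨hp, _⟩
        · exact absurd rfl h₁
        · exact hp
      subst hq
      rcases hlower_spec p ha hp with hfix | ⟨-, -, n, p₂, rfl⟩
      · rw [hfix] at h₁; exact absurd rfl h₁
      · unfold hLogEta
        rw [dif_neg (fun H => h₁ (HL.1 H)), dif_neg (fun H => h₂ (HN.1 H)), dif_neg h₁, dif_neg h₂]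
        erw [hstep_comp Δ r₁ p₂]
        ext x
        simp only [NatTrans.comp_app, eqToHom_app, Functor.whiskerLeft_app, Functor.whiskerRight_app,
          DiagramOfCategories.pathFunctor'_nil, Functor.id_map, eqToHom_refl, Category.comp_id]
        erw [Category.assoc, Category.assoc, eqToHom_trans]
        rfl

/-- **The family of homotopies `𝔖_log`** on `𝒟_{≤3}` for input data of holomorphic type
(`ι_× = ι : λ^× → λ^{×pf}`): boundary set `HLogRel`, homotopies `hLogEta`, transported to t2's
`pathFunctor` by `HomotopyFamily.mkOfStrict`. [cite: MochizukiAbsTopIII2015, Corollary 3.6 (iii) p.81] -/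
noncomputable def hLogFamily : Δ.sub3.HomotopyFamily :=
  DiagramOfCategories.HomotopyFamily.mkOfStrict HLogRel isSaturated_hLogRel
    (fun _ _ _ _ h => hLogEta Δ ι h) (fun _ _ _ h => hLogEta_refl Δ ι h)
    (fun _ _ _ _ _ h₁ h₂ => hLogEta_trans Δ ι h₁ h₂) (fun _ _ _ _ _ _ h r₁ r₂ => hLogEta_whisker Δ ι h r₁ r₂)

/-! ### Generation by the printed pairs, pinning, and the statement -/

/-- Holomorphic orientation: the basic type-(2) pair is `([λ^×], [λ^{×pf}])`.
[cite: MochizukiAbsTopIII2015, Corollary 3.6 (iii) p.81] -/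
theorem timesPairLeft_eq_inl (hι : Δ.ιtimes = Sum.inl ι) :
    Δ.timesPairLeft = (Path.nil : Path lvNexus.{u} lvNexus).cons eLamTimes := by
  unfold LogFrobeniusData.timesPairLeft; rw [hι]

/-- Holomorphic orientation: the basic type-(2) pair is `([λ^×], [λ^{×pf}])`.
[cite: MochizukiAbsTopIII2015, Corollary 3.6 (iii) p.81] -/
theorem timesPairRight_eq_inl (hι : Δ.ιtimes = Sum.inl ι) :
    Δ.timesPairRight = (Path.nil : Path lvNexus.{u} lvNexus).cons eLamPf := by
  unfold LogFrobeniusData.timesPairRight; rw [hι]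

/-- A precomposed type-(2) pair lies in the saturation of the generators.
[cite: MochizukiAbsTopIII2015, Corollary 3.6 (iii) p.81] -/
theorem hsat_timesPair (hι : Δ.ιtimes = Sum.inl ι) {a : V3.{u}} (p₀ : Path a lvNexus.{u}) :
    Saturation Δ.LogGen (p₀.cons eLamTimes) (p₀.cons eLamPf) := by
  have h := Saturation.precomp p₀ (Saturation.base (LogFrobeniusData.LogGen.type2 (Δ := Δ)))
  rw [timesPairLeft_eq_inl Δ ι hι, timesPairRight_eq_inl Δ ι hι] at h
  exact h

/-- **`E_log` is generated by the printed pairs** (holomorphic orientation; t5's `LogGen`).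
[cite: MochizukiAbsTopIII2015, Corollary 3.6 (iii) p.81] -/
theorem hLogRel_iff_saturation (hι : Δ.ιtimes = Sum.inl ι) {a b : V3.{u}} (p q : Path a b) :
    HLogRel p q ↔ Saturation Δ.LogGen p q := by
  constructor
  · rintro ⟨rfl, ha, h⟩
    rcases h with hqp | ⟨hp, rfl | rfl⟩
    · -- reflexive pairs: every path into `𝒩` occurs in a type-(2) pair
      rw [hqp]
      cases p with
      | nil => exact absurd rfl ha
      | cons p₀ e =>
        obtain rfl := eq_nexus_of_hom_obs e
        rcases hom_obs_eq e with rfl | rfl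
        · exact (hsat_timesPair Δ ι hι p₀).refl_left
        · exact (hsat_timesPair Δ ι hι p₀).refl_right
    · obtain ⟨p₀, rfl⟩ := exists_eq_cons_lamTimes p ha hp
      exact hsat_timesPair Δ ι hι p₀
    · rcases hlower_spec p ha hp with hfix | ⟨-, -, n, p₂, rfl⟩
      · rw [hfix]
        obtain ⟨p₀, rfl⟩ := exists_eq_cons_lamTimes p ha hp
        exact (hsat_timesPair Δ ι hι p₀).refl_left
      · exact Saturation.precomp p₂ (Saturation.base (LogFrobeniusData.LogGen.type1 (Δ := Δ) n))
  · intro h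
    induction h with
    | base hg =>
      cases hg with
      | type1 n => exact ⟨rfl, lvRow1_ne_lvObs _, Or.inr ⟨rfl, Or.inr rfl⟩⟩
      | type2 =>
        rw [timesPairLeft_eq_inl Δ ι hι, timesPairRight_eq_inl Δ ι hι]
        exact ⟨rfl, lvNexus_ne_lvObs, Or.inr ⟨rfl, Or.inl rfl⟩⟩
    | refl_left _ ih => exact isSaturated_hLogRel.refl_left ih
    | refl_right _ ih => exact isSaturated_hLogRel.refl_right ih
    | trans _ _ ih₁ ih₂ => exact isSaturated_hLogRel.trans ih₁ ih₂
    | precomp r _ ih => exact isSaturated_hLogRel.precomp ih r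
    | postcomp r _ ih => exact isSaturated_hLogRel.postcomp ih r

/-- Computation rule for the homotopies of `hLogFamily`. [cite: MochizukiAbsTopIII2015, Corollary
3.6 (iii) p.81] -/
theorem hLogFamily_η {a b : V3.{u}} {p q : Path a b} (h : HLogRel p q) :
    (hLogFamily Δ ι).η h = eqToHom (Δ.sub3.pathFunctor_eq_pathFunctor' p) ≫ hLogEta Δ ι h ≫
      eqToHom (Δ.sub3.pathFunctor_eq_pathFunctor' q).symm := rfl

/-- On the basic type-(2) pair the homotopy is `ι_×`. [cite: MochizukiAbsTopIII2015, Corollary 3.6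
(iii) p.81] -/
theorem hLogEta_timesPair (h : HLogRel ((Path.nil : Path lvNexus.{u} lvNexus).cons eLamTimes)
    ((Path.nil : Path lvNexus.{u} lvNexus).cons eLamPf)) :
    hLogEta Δ ι h = Functor.whiskerLeft (𝟭 _) ι ≫ eqToHom rfl := rfl

/-- On the basic type-(1) pair the homotopy is `ι_log,⋎`. [cite: MochizukiAbsTopIII2015, Corollary
3.6 (iii) p.81] -/
theorem hLogEta_logPair (n : ℤ) (h : HLogRel (logPairLeft.{u} n) (logPairRight.{u} n)) :
    hLogEta Δ ι h = Functor.whiskerLeft (𝟭 _) Δ.ιlog ≫ eqToHom rfl := rfl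

/-- **Cor. 3.6 (iii), first clause, over the abstract data**: for input data of holomorphic type the
printed natural transformations `ι_log,⋎`, `ι_×` generate a family of homotopies on `𝒟_{≤3}` that
determines an observable `𝔖_log` on `𝒟_{≤2}` — t5's pinned `ObservableLogStmt` holds (family
`hLogFamily`). [cite: MochizukiAbsTopIII2015, Corollary 3.6 (iii) p.81] -/
theorem observableLogStmt_of_inl (hι : Δ.ιtimes = Sum.inl ι) : Δ.ObservableLogStmt := by
  refine ⟨hLogFamily Δ ι, fun a b p q => hLogRel_iff_saturation Δ ι hι p q, fun a b p q h => h.1, ?_⟩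
  unfold LogFrobeniusData.LogPinned
  rw [hι]
  refine ⟨⟨⟨rfl, lvNexus_ne_lvObs, Or.inr ⟨rfl, Or.inl rfl⟩⟩, fun x e₁ e₂ => ?_⟩,
    fun n => ⟨⟨rfl, lvRow1_ne_lvObs _, Or.inr ⟨rfl, Or.inr rfl⟩⟩, fun x e₁ e₂ => ?_⟩⟩
  · rw [hLogFamily_η, hLogEta_timesPair]
    simp only [NatTrans.comp_app, eqToHom_app, Functor.whiskerLeft_app, eqToHom_refl, Category.comp_id]
    rfl
  · rw [hLogFamily_η, hLogEta_logPair]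
    simp only [NatTrans.comp_app, eqToHom_app, Functor.whiskerLeft_app, eqToHom_refl, Category.comp_id]
    rfl

end Family

end Literature.AnabelianGeometry.AbsoluteAnabelian.AbsTopIII
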